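import Summits.QuantumFields.YangMills.Theorems.BalabanUVNodesN15AtRateRecord12V1
import Summits.QuantumFields.YangMills.Theorems.BalabanUVNodesN15AtRateRecord13
import Summits.QuantumFields.YangMills.Theorems.BalabanUVNodesN15AtTupleReading13
import Summits.QuantumFields.YangMills.Theorems.BalabanUVNodesRateReadingOfRecord13

/-!
# Route «BalabanUVNodes», cluster K4 «SpineRates» — node N15 = NE2 AT dag-n22-e's STAGE-13 READING OF RECORD `readingOfRecord₁₃ w1 ℓ₃ ne2 ne1` (p495075) AND AT
# THE K3‴ COMPOSER's TUPLE READING OF RECORD `rr := rateCarriersOfRecord₁₃ (readingOfRecord₁₃ …) … (ksel …)`: the θ-sufficient `h15`, the `V′₁(A)`∕`V′₁(A′)`-live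
# families, the LG-vector knit, the constant residual layers, populatedness, and N15's conjunct of `KeyedRates rr` — the ₁₃ twin of part 32 §2–§4 plus the tuple bridge

Cell `pub-ymgap`, seat `pub-ymgap-dag-n15-a` (-a KNIT-BY-NAME seat of node N15; HUMAN RULING D-0062; chair R424 venue), generation 11, part 38 (THEOREMS ONLY, 0 `def`,
0 `sorry`).  `bears_on: R4∕N15 · K3‴ SpineGivenEndpointR13 (stmt-QuantumFields-19912)`.  Filed `--supports stmt-QuantumFields-19912 --as helper`.  Imports this seat's part 32
`…N15AtRateRecord12V1` (p484013: the stage-free keyed-home faces `s_N15_of_admits_v1∕_v1G`, `populated_v1Objects∕_v1GObjects`), part 33 `…N15AtRateRecord13` (p494009: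
`admits_rRec₁₃_ne2`, `s_N15_rRec₁₃_of_forall_admissible`), part 36 `…N15AtTupleReading13` (p495617) and dag-n22-e's 6″ `…RateReadingOfRecord13` (p495075: `readingOfRecord₁₃`,
its `rfl` faces, `readingOfRecord₁₃_populated_iff`; consumers named there: «n15-a (`s_N15_readingOfRecord₁₃_iff`)», «n27-c (the K3‴ composer's `rr` of record =
`fun F θ hP g₀ os => rateCarriersOfRecord₁₃ (readingOfRecord₁₃ w1 ℓ₃ ne2 ne1) F θ hP g₀ os (ksel …)`)»).  Restate-immune (no Theses import).

CONTENTS.  §2 `s_N15_rRec₁₃_of_v1` (any Stage-13 rate reading `𝔯` whose NE2 literals are `V′₁` literals + the two displayed layers ⇒ `S_N15 (RRec₁₃ 𝔯)`).  §3 at the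
reading of record: ★ `s_N15_readingOfRecord₁₃_of_v1`, `populated_readingOfRecord₁₃_of_v1`, `s_N15_readingOfRecord₁₃_v1Const`, `populated_readingOfRecord₁₃_v1Const`.
§4 the gauge-field-as-datum family: `s_N15_rRec₁₃_of_v1G`, `s_N15_readingOfRecord₁₃_of_v1G`, `…_v1GConst`, `populated_readingOfRecord₁₃_v1GConst`.  §5 ANY residual layer:
★ **`s_N15_readingOfRecord₁₃_of_forall_admissible`** (= dag-n27-c's `h15` at `RRec₁₃ (readingOfRecord₁₃ w1 ℓ₃ ne2 ne1)`: the N15 estimate at `ne2OfRecord₁₁ (ne2 F θ g₀ os k)` for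
every admissible tuple with provisos), ★ `s_N15_readingOfRecord₁₃_of_knit_family` (the `U ≡ 1` knit layer: HYPOTHESIS-FREE).  §6 THE TUPLE BRIDGE for the composer's `rr`:
`n15_tupleReadingOfRecord₁₃_iff` (`Iff.rfl`), ★ **`n15_tupleReadingOfRecord₁₃_of_forall`** (estimate at every run length ⇒ N15's conjunct of `KeyedRates rr`, any selector `ksel`),
★ `n15_tupleReadingOfRecord₁₃_of_knit_family` (hypothesis-free), ★ `n15_tupleReadingOfRecord₁₃_of_v1` (dag-n15-c's `V′₁(A)`-live layer; operator layer = the producer's theorem).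

HONEST FRAMING.  Kernel bookkeeping BY NAME; no estimate is proved here; the residual layer `ne2` is a PARAMETER — Bałaban's run-indexed paired instances with backgrounds
LIVE (the η-pairing of Node 00's [B9] letters) are NOT pinned by any definer; the hypothesis-free inhabitants are the `U ≡ 1` LG-vector torus MODEL and dag-n15-c's LINEAR
vector piece dressed by the linearised first-order species — NOT `G(U)`; no admissible Stage-13 tuple with provisos is claimed to exist (K0‴ `Record13Inhabited`,
stmt-QuantumFields-19909, OPEN); NE2⁺ NOT PRINTED beyond King's scalar template; **N15 is NOT discharged**; `stub_rates13` is NOT claimed; count-neutral (typed 28∕28 ·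
discharged 5∕28 unchanged); one finite four-torus at fixed ε — NOT ℝ⁴, NOT infinite volume, NOT OS, NOT a mass gap, NOT Clay.  No decl below carries a cite tag.
-/

set_option autoImplicit false

noncomputable section
namespace Summit.QuantumFields.YangMills.BalabanUVNodes.N15.AtRateReadingOfRecord13

open Literature.MathematicalPhysics.QuantumFieldTheory.Balaban1983to89
open Literature.MathematicalPhysics.QuantumFieldTheory.Balaban1983to89.T4Continuum (T4Family ULoop)
open Literature.MathematicalPhysics.QuantumFieldTheory.Balaban1983to89.T4EtaRate (PairedInstance NE2PlusOperator NE2PlusSite NE2PlusUnit)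
open Literature.MathematicalPhysics.QuantumFieldTheory.Balaban1983to89.NE2NodeTorus (KnitIndex knitInstance knitOp knitOp166 knitSite163 covOpKernels
  inAll rhoDist)
open Node00 (IsDatumOfRecord₁₃C Stage13Params NE2Objects₁₁ NE3Letters₁₁)
open Node00.W1 (ReadingData)
open Summit.QuantumFields.BalabanUV.T4Continuum.HistoryFlow (two_le_L)
open Summit.QuantumFields.YangMills.Theorems.BalabanUVNodesN15Knit (N15_with_zero_layers_dim4)
open Summit.QuantumFields.YangMills.Theorems.N15AtSpineCarriers (s_N15_of_v1Reading s_N15_of_v1GReading n15At_vectorPiece_v1_of_layers)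
open Summit.QuantumFields.YangMills.BalabanUVNodes.N15.VectorPiece (VecIndexS vecIndexS_nonempty v1VecInstance v1VecFamily4 v1GVecInstance
  v1GVecFamily4)
open Summit.QuantumFields.YangMills.BalabanUVNodes.N15.AtKeyedHome (s_N15_of_admits neZero_blockFactor)
open Summit.QuantumFields.YangMills.BalabanUVNodes.N15.AtRateRecord12V1 (s_N15_of_admits_v1 s_N15_of_admits_v1G populated_v1Objects populated_v1GObjects)
open Summit.QuantumFields.YangMills.BalabanUVNodes.N15.AtRateRecord13 (admits_rRec₁₃_ne2 s_N15_rRec₁₃_of_forall_admissible)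
open Summit.QuantumFields.YangMills.BalabanUVNodes.N15.AtTupleReading13 (n15_tupleReading_of_pin)
open YMDAG.UVSplit (Datum NE1pCarriers NE2Carriers RateCarriers RateRecordPred N15At S_N15 ne2OfRecord₁₁ RateReading₁₃ RRec₁₃ rateCarriersOfRecord₁₃
  readingOfRecord₁₃ readingOfRecord₁₃_ne2 readingOfRecord₁₃_populated_iff)

variable {N : ℕ} [NeZero N] {d : ℕ} {L : ℕ} [NeZero L] {ι : Type} [Fintype ι] [DecidableEq ι]
  {𝔄 : Type} [NormedRing 𝔄] [NormedAlgebra ℝ 𝔄] [CompleteSpace 𝔄] (e : 𝔄 ≃L[ℝ] (ι → ℝ))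

/-! ## §2 The Stage-13 home `RRec₁₃ 𝔯`: the `V′₁(A)` literals -/

/-- **THE `V′₁(A)`-LIVE OPERATOR LAYER AT THE STAGE-12 HOME.**  For `d + 1 ≥ 2`, `L ≥ 1`: if at every family, every Stage-13 datum of record (key `hD`),
every `(g₀, os)` and every run length the reading's NE2 objects `(𝔯.lit F hD.params hD.provisos g₀ os).ne2 k` ARE the `V′₁` carriers together with the
SITE and UNIT layers on them, then `S_N15 (RRec₁₃ 𝔯)` (§1 at the certificate `AtRateRecord13.admits_rRec₁₃_ne2`); the operator conjunct is dag-n15-c's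
theorem, NOT a hypothesis. [bookkeeping] -/
theorem s_N15_rRec₁₃_of_v1 (hd : 1 ≤ d) (hL : 1 ≤ L) (𝔯 : RateReading₁₃ N)
    (h : ∀ (F : T4Family) (D : Datum F N) (hD : IsDatumOfRecord₁₃C F N D) (g₀ : ℕ → ℝ) (os : List (ULoop F)) (k : ℕ),
      ∃ (c35 p : ℝ) (Ksite Kunit : ∀ j : VecIndexS d L, B9.SiteKernel (v1VecInstance (d := d) 𝔄 ι L hL j).gc (v1VecInstance (d := d) 𝔄 ι L hL j).Bf)
        (inΛ : ∀ j : VecIndexS d L, (v1VecInstance (d := d) 𝔄 ι L hL j).gc.Site → Prop)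
        (unitDist : ∀ j : VecIndexS d L, (v1VecInstance (d := d) 𝔄 ι L hL j).gc.Site → (v1VecInstance (d := d) 𝔄 ι L hL j).gc.Site → ℝ),
        0 < c35 ∧
        (𝔯.lit F hD.params hD.provisos g₀ os).ne2 k =
          { I := VecIndexS d L, c35 := c35, p := p, pi := v1VecInstance (d := d) 𝔄 ι L hL, Kop := v1VecFamily4 (d := d) 𝔄 ι e L hL,
            Ksite := Ksite, Kunit := Kunit, inΛ := inΛ, unitDist := unitDist } ∧
        NE2PlusSite 4 p c35 (v1VecInstance (d := d) 𝔄 ι L hL) Ksite ∧ NE2PlusUnit c35 (v1VecInstance (d := d) 𝔄 ι L hL) Kunit inΛ unitDist) :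
    S_N15 (RRec₁₃ 𝔯) :=
  s_N15_of_admits_v1 e (fun {F D} (hD : IsDatumOfRecord₁₃C F N D) g₀ os k => (𝔯.lit F hD.params hD.provisos g₀ os).ne2 k)
    (RRec₁₃ 𝔯) hd hL (admits_rRec₁₃_ne2 𝔯) h

/-! ## §3 The reading of record, edition 1: N15's residual layer `ne2` read at `V′₁` literals -/

section ReadingOfRecord

variable (w1 : (F : T4Family) → (θ : Stage13Params F N) → ReadingData F (Node00.MatA N) θ.τ9.M) (ℓ₃ : T4Family → NE3Letters₁₁)
  (ne2 : (F : T4Family) → Stage13Params F N → (ℕ → ℝ) → List (ULoop F) → ℕ → NE2Objects₁₁)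
  (ne1 : (F : T4Family) → Stage13Params F N → (ℕ → ℝ) → List (ULoop F) → NE1pCarriers)

/-- **N15 AT THE READING OF RECORD (EDITION 1) WITH A `V′₁(A)`-LIVE RESIDUAL LAYER.**  For `d + 1 ≥ 2`, `L ≥ 1`: if N15's residual layer `ne2` of
dag-n22-e's `readingOfRecord₁₃ w1 ℓ₃ ne2 ne1` takes, at every family, Stage-13 parameter with provisos, `(g₀, os)` and run length, a `V′₁` literal as value
together with the SITE and UNIT layers on it, then the K4 stub `S_N15` holds at the home of the reading of record — the N15 slot of K3′'s rate side
(dag-n27-c's `h15` at `RRec₁₃ (readingOfRecord₁₃ …)`), with the OPERATOR layer by the producer's theorem and exactly the two displayed layers owed.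
W1's towers `w1`, the NE3 letters `ℓ₃` and NODE O's `ne1` are idle (component locality). [bookkeeping] -/
theorem s_N15_readingOfRecord₁₃_of_v1 (hd : 1 ≤ d) (hL : 1 ≤ L)
    (h : ∀ (F : T4Family) (θ : Stage13Params F N), θ.Provisos₁₃ F N → ∀ (g₀ : ℕ → ℝ) (os : List (ULoop F)) (k : ℕ),
      ∃ (c35 p : ℝ) (Ksite Kunit : ∀ j : VecIndexS d L, B9.SiteKernel (v1VecInstance (d := d) 𝔄 ι L hL j).gc (v1VecInstance (d := d) 𝔄 ι L hL j).Bf)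
        (inΛ : ∀ j : VecIndexS d L, (v1VecInstance (d := d) 𝔄 ι L hL j).gc.Site → Prop)
        (unitDist : ∀ j : VecIndexS d L, (v1VecInstance (d := d) 𝔄 ι L hL j).gc.Site → (v1VecInstance (d := d) 𝔄 ι L hL j).gc.Site → ℝ),
        0 < c35 ∧
        ne2 F θ g₀ os k =
          { I := VecIndexS d L, c35 := c35, p := p, pi := v1VecInstance (d := d) 𝔄 ι L hL, Kop := v1VecFamily4 (d := d) 𝔄 ι e L hL,
            Ksite := Ksite, Kunit := Kunit, inΛ := inΛ, unitDist := unitDist } ∧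
        NE2PlusSite 4 p c35 (v1VecInstance (d := d) 𝔄 ι L hL) Ksite ∧ NE2PlusUnit c35 (v1VecInstance (d := d) 𝔄 ι L hL) Kunit inΛ unitDist) :
    S_N15 (RRec₁₃ (readingOfRecord₁₃ w1 ℓ₃ ne2 ne1)) :=
  s_N15_rRec₁₃_of_v1 e hd hL (readingOfRecord₁₃ w1 ℓ₃ ne2 ne1) fun F _ hD g₀ os k => by
    rw [readingOfRecord₁₃_ne2]
    exact h F hD.params hD.provisos g₀ os k

omit [CompleteSpace 𝔄] in
/-- **SUCH A READING OF RECORD IS POPULATED** (RR-1's display, all three thirds): if the residual layer `ne2` takes `V′₁` literals as values at every run length,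
the reading of record is `Populated` at every Stage-13 parameter with provisos (dag-n22-e's `readingOfRecord₁₃_populated_iff`: W1's U3 layer and RR-1's constant NE3
layer are populated unconditionally; the last third is `populated_v1Objects`). [bookkeeping] -/
theorem populated_readingOfRecord₁₃_of_v1 (hL : 1 ≤ L) (F : T4Family) (θ : Stage13Params F N) (hP : θ.Provisos₁₃ F N) (g₀ : ℕ → ℝ)
    (os : List (ULoop F))
    (h : ∀ k : ℕ, ∃ (c35 p : ℝ)
        (Ksite Kunit : ∀ j : VecIndexS d L, B9.SiteKernel (v1VecInstance (d := d) 𝔄 ι L hL j).gc (v1VecInstance (d := d) 𝔄 ι L hL j).Bf)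
        (inΛ : ∀ j : VecIndexS d L, (v1VecInstance (d := d) 𝔄 ι L hL j).gc.Site → Prop)
        (unitDist : ∀ j : VecIndexS d L, (v1VecInstance (d := d) 𝔄 ι L hL j).gc.Site → (v1VecInstance (d := d) 𝔄 ι L hL j).gc.Site → ℝ),
        ne2 F θ g₀ os k =
          { I := VecIndexS d L, c35 := c35, p := p, pi := v1VecInstance (d := d) 𝔄 ι L hL, Kop := v1VecFamily4 (d := d) 𝔄 ι e L hL,
            Ksite := Ksite, Kunit := Kunit, inΛ := inΛ, unitDist := unitDist }) :
    ((readingOfRecord₁₃ w1 ℓ₃ ne2 ne1).lit F θ hP g₀ os).Populated := by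
  refine (readingOfRecord₁₃_populated_iff w1 ℓ₃ ne2 ne1 F θ hP g₀ os).2 fun k => ?_
  obtain ⟨c35, p, Ksite, Kunit, inΛ, unitDist, hk⟩ := h k
  rw [hk]
  exact populated_v1Objects e hL c35 p Ksite Kunit inΛ unitDist

end ReadingOfRecord

/-! ### The constant residual layer at one `V′₁` literal -/

section Const

variable (w1 : (F : T4Family) → (θ : Stage13Params F N) → ReadingData F (Node00.MatA N) θ.τ9.M) (ℓ₃ : T4Family → NE3Letters₁₁)
  (ne1 : (F : T4Family) → Stage13Params F N → (ℕ → ℝ) → List (ULoop F) → NE1pCarriers)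

/-- **THE CONSTANT `V′₁` RESIDUAL LAYER CLOSES N15's SLOT AT THE READING OF RECORD MODULO THE TWO DISPLAYED LAYERS** [decided toy, non-degenerate]: with
`ne2 := fun _ _ _ _ _ => o`, `o` the `V′₁` literal at letters `(c35 > 0, p)` and site ∕ unit kernels `Ksite`, `Kunit`, region `inΛ`, unit distance `unitDist`,
the stub `S_N15 (RRec₁₃ (readingOfRecord₁₃ w1 ℓ₃ ne2 ne1))` follows from the SITE and UNIT layers on the `V′₁` carriers ALONE — the operator layer with
the background LIVE is dag-n15-c's theorem.  A MODEL-level reading NAMED here, not NODE 00's objects of record. [bookkeeping] -/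
theorem s_N15_readingOfRecord₁₃_v1Const (hd : 1 ≤ d) (hL : 1 ≤ L) {c35 : ℝ} (hc35 : 0 < c35) (p : ℝ)
    (Ksite Kunit : ∀ j : VecIndexS d L, B9.SiteKernel (v1VecInstance (d := d) 𝔄 ι L hL j).gc (v1VecInstance (d := d) 𝔄 ι L hL j).Bf)
    (inΛ : ∀ j : VecIndexS d L, (v1VecInstance (d := d) 𝔄 ι L hL j).gc.Site → Prop)
    (unitDist : ∀ j : VecIndexS d L, (v1VecInstance (d := d) 𝔄 ι L hL j).gc.Site → (v1VecInstance (d := d) 𝔄 ι L hL j).gc.Site → ℝ)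
    (hsite : NE2PlusSite 4 p c35 (v1VecInstance (d := d) 𝔄 ι L hL) Ksite)
    (hunit : NE2PlusUnit c35 (v1VecInstance (d := d) 𝔄 ι L hL) Kunit inΛ unitDist) :
    S_N15 (RRec₁₃ (readingOfRecord₁₃ w1 ℓ₃
      (fun _ _ _ _ _ =>
        { I := VecIndexS d L, c35 := c35, p := p, pi := v1VecInstance (d := d) 𝔄 ι L hL, Kop := v1VecFamily4 (d := d) 𝔄 ι e L hL,
          Ksite := Ksite, Kunit := Kunit, inΛ := inΛ, unitDist := unitDist }) ne1)) :=
  s_N15_readingOfRecord₁₃_of_v1 e w1 ℓ₃ _ ne1 hd hL fun _ _ _ _ _ _ =>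
    ⟨c35, p, Ksite, Kunit, inΛ, unitDist, hc35, rfl, hsite, hunit⟩

omit [CompleteSpace 𝔄] in
/-- **… AND THAT READING OF RECORD IS POPULATED EVERYWHERE** (RR-1's display met at every Stage-13 parameter with provisos). [bookkeeping] -/
theorem populated_readingOfRecord₁₃_v1Const (hL : 1 ≤ L) (c35 p : ℝ)
    (Ksite Kunit : ∀ j : VecIndexS d L, B9.SiteKernel (v1VecInstance (d := d) 𝔄 ι L hL j).gc (v1VecInstance (d := d) 𝔄 ι L hL j).Bf)
    (inΛ : ∀ j : VecIndexS d L, (v1VecInstance (d := d) 𝔄 ι L hL j).gc.Site → Prop)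
    (unitDist : ∀ j : VecIndexS d L, (v1VecInstance (d := d) 𝔄 ι L hL j).gc.Site → (v1VecInstance (d := d) 𝔄 ι L hL j).gc.Site → ℝ)
    (F : T4Family) (θ : Stage13Params F N) (hP : θ.Provisos₁₃ F N) (g₀ : ℕ → ℝ) (os : List (ULoop F)) :
    ((readingOfRecord₁₃ w1 ℓ₃
      (fun _ _ _ _ _ =>
        { I := VecIndexS d L, c35 := c35, p := p, pi := v1VecInstance (d := d) 𝔄 ι L hL, Kop := v1VecFamily4 (d := d) 𝔄 ι e L hL,
          Ksite := Ksite, Kunit := Kunit, inΛ := inΛ, unitDist := unitDist }) ne1).lit F θ hP g₀ os).Populated :=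
  populated_readingOfRecord₁₃_of_v1 e w1 ℓ₃ _ ne1 hL F θ hP g₀ os fun _ => ⟨c35, p, Ksite, Kunit, inΛ, unitDist, rfl⟩

end Const

/-! ## §4 The gauge-field-as-datum family  (dag-n15-c (V4)) at Stage 13 -/

/-- **THE `V′₁(A′)`-LIVE OPERATOR LAYER AT THE STAGE-12 HOME** (§4's `s_N15_of_admits_v1G` at the certificate `AtRateRecord13.admits_rRec₁₃_ne2`). [bookkeeping] -/
theorem s_N15_rRec₁₃_of_v1G (hd : 1 ≤ d) (hL : 1 ≤ L) (𝔯 : RateReading₁₃ N)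
    (h : ∀ (F : T4Family) (D : Datum F N) (hD : IsDatumOfRecord₁₃C F N D) (g₀ : ℕ → ℝ) (os : List (ULoop F)) (k : ℕ),
      ∃ (c35 p : ℝ) (Ksite Kunit : ∀ j : VecIndexS d L, B9.SiteKernel (v1GVecInstance (d := d) 𝔄 ι L hL j).gc (v1GVecInstance (d := d) 𝔄 ι L hL j).Bf)
        (inΛ : ∀ j : VecIndexS d L, (v1GVecInstance (d := d) 𝔄 ι L hL j).gc.Site → Prop)
        (unitDist : ∀ j : VecIndexS d L, (v1GVecInstance (d := d) 𝔄 ι L hL j).gc.Site → (v1GVecInstance (d := d) 𝔄 ι L hL j).gc.Site → ℝ),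
        0 < c35 ∧
        (𝔯.lit F hD.params hD.provisos g₀ os).ne2 k =
          { I := VecIndexS d L, c35 := c35, p := p, pi := v1GVecInstance (d := d) 𝔄 ι L hL, Kop := v1GVecFamily4 (d := d) 𝔄 ι e L hL,
            Ksite := Ksite, Kunit := Kunit, inΛ := inΛ, unitDist := unitDist } ∧
        NE2PlusSite 4 p c35 (v1GVecInstance (d := d) 𝔄 ι L hL) Ksite ∧ NE2PlusUnit c35 (v1GVecInstance (d := d) 𝔄 ι L hL) Kunit inΛ unitDist) :
    S_N15 (RRec₁₃ 𝔯) :=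
  s_N15_of_admits_v1G e (fun {F D} (hD : IsDatumOfRecord₁₃C F N D) g₀ os k => (𝔯.lit F hD.params hD.provisos g₀ os).ne2 k)
    (RRec₁₃ 𝔯) hd hL (admits_rRec₁₃_ne2 𝔯) h

section GaugeReadingOfRecord

variable (w1 : (F : T4Family) → (θ : Stage13Params F N) → ReadingData F (Node00.MatA N) θ.τ9.M) (ℓ₃ : T4Family → NE3Letters₁₁)
  (ne2 : (F : T4Family) → Stage13Params F N → (ℕ → ℝ) → List (ULoop F) → ℕ → NE2Objects₁₁)
  (ne1 : (F : T4Family) → Stage13Params F N → (ℕ → ℝ) → List (ULoop F) → NE1pCarriers)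

/-- **N15 AT THE READING OF RECORD (EDITION 1) WITH A `V′₁(A′)`-LIVE RESIDUAL LAYER** (§3's `s_N15_readingOfRecord₁₃_of_v1` for the gauge-field-as-datum
family): every residual layer `ne2` valued in `V′₁(A′)` literals carrying the two displayed layers closes `S_N15 (RRec₁₃ (readingOfRecord₁₃ w1 ℓ₃ ne2 ne1))`,
operator third by the producer's theorem. [bookkeeping] -/
theorem s_N15_readingOfRecord₁₃_of_v1G (hd : 1 ≤ d) (hL : 1 ≤ L)
    (h : ∀ (F : T4Family) (θ : Stage13Params F N), θ.Provisos₁₃ F N → ∀ (g₀ : ℕ → ℝ) (os : List (ULoop F)) (k : ℕ),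
      ∃ (c35 p : ℝ) (Ksite Kunit : ∀ j : VecIndexS d L, B9.SiteKernel (v1GVecInstance (d := d) 𝔄 ι L hL j).gc (v1GVecInstance (d := d) 𝔄 ι L hL j).Bf)
        (inΛ : ∀ j : VecIndexS d L, (v1GVecInstance (d := d) 𝔄 ι L hL j).gc.Site → Prop)
        (unitDist : ∀ j : VecIndexS d L, (v1GVecInstance (d := d) 𝔄 ι L hL j).gc.Site → (v1GVecInstance (d := d) 𝔄 ι L hL j).gc.Site → ℝ),
        0 < c35 ∧
        ne2 F θ g₀ os k =
          { I := VecIndexS d L, c35 := c35, p := p, pi := v1GVecInstance (d := d) 𝔄 ι L hL, Kop := v1GVecFamily4 (d := d) 𝔄 ι e L hL,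
            Ksite := Ksite, Kunit := Kunit, inΛ := inΛ, unitDist := unitDist } ∧
        NE2PlusSite 4 p c35 (v1GVecInstance (d := d) 𝔄 ι L hL) Ksite ∧ NE2PlusUnit c35 (v1GVecInstance (d := d) 𝔄 ι L hL) Kunit inΛ unitDist) :
    S_N15 (RRec₁₃ (readingOfRecord₁₃ w1 ℓ₃ ne2 ne1)) :=
  s_N15_rRec₁₃_of_v1G e hd hL (readingOfRecord₁₃ w1 ℓ₃ ne2 ne1) fun F _ hD g₀ os k => by
    rw [readingOfRecord₁₃_ne2]
    exact h F hD.params hD.provisos g₀ os k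

end GaugeReadingOfRecord

section GaugeConst

variable (w1 : (F : T4Family) → (θ : Stage13Params F N) → ReadingData F (Node00.MatA N) θ.τ9.M) (ℓ₃ : T4Family → NE3Letters₁₁)
  (ne1 : (F : T4Family) → Stage13Params F N → (ℕ → ℝ) → List (ULoop F) → NE1pCarriers)

/-- **THE CONSTANT `V′₁(A′)` RESIDUAL LAYER CLOSES N15's SLOT AT THE READING OF RECORD MODULO THE TWO DISPLAYED LAYERS** [decided toy, non-degenerate]
(§3's `s_N15_readingOfRecord₁₃_v1Const` for the gauge-field-as-datum family). [bookkeeping] -/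
theorem s_N15_readingOfRecord₁₃_v1GConst (hd : 1 ≤ d) (hL : 1 ≤ L) {c35 : ℝ} (hc35 : 0 < c35) (p : ℝ)
    (Ksite Kunit : ∀ j : VecIndexS d L, B9.SiteKernel (v1GVecInstance (d := d) 𝔄 ι L hL j).gc (v1GVecInstance (d := d) 𝔄 ι L hL j).Bf)
    (inΛ : ∀ j : VecIndexS d L, (v1GVecInstance (d := d) 𝔄 ι L hL j).gc.Site → Prop)
    (unitDist : ∀ j : VecIndexS d L, (v1GVecInstance (d := d) 𝔄 ι L hL j).gc.Site → (v1GVecInstance (d := d) 𝔄 ι L hL j).gc.Site → ℝ)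
    (hsite : NE2PlusSite 4 p c35 (v1GVecInstance (d := d) 𝔄 ι L hL) Ksite)
    (hunit : NE2PlusUnit c35 (v1GVecInstance (d := d) 𝔄 ι L hL) Kunit inΛ unitDist) :
    S_N15 (RRec₁₃ (readingOfRecord₁₃ w1 ℓ₃
      (fun _ _ _ _ _ =>
        { I := VecIndexS d L, c35 := c35, p := p, pi := v1GVecInstance (d := d) 𝔄 ι L hL, Kop := v1GVecFamily4 (d := d) 𝔄 ι e L hL,
          Ksite := Ksite, Kunit := Kunit, inΛ := inΛ, unitDist := unitDist }) ne1)) :=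
  s_N15_readingOfRecord₁₃_of_v1G e w1 ℓ₃ _ ne1 hd hL fun _ _ _ _ _ _ =>
    ⟨c35, p, Ksite, Kunit, inΛ, unitDist, hc35, rfl, hsite, hunit⟩

omit [CompleteSpace 𝔄] in
/-- **… AND THAT READING OF RECORD IS POPULATED EVERYWHERE** (n22-e's `readingOfRecord₁₃_populated_iff` with `populated_v1GObjects`). [bookkeeping] -/
theorem populated_readingOfRecord₁₃_v1GConst (hL : 1 ≤ L) (c35 p : ℝ)
    (Ksite Kunit : ∀ j : VecIndexS d L, B9.SiteKernel (v1GVecInstance (d := d) 𝔄 ι L hL j).gc (v1GVecInstance (d := d) 𝔄 ι L hL j).Bf)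
    (inΛ : ∀ j : VecIndexS d L, (v1GVecInstance (d := d) 𝔄 ι L hL j).gc.Site → Prop)
    (unitDist : ∀ j : VecIndexS d L, (v1GVecInstance (d := d) 𝔄 ι L hL j).gc.Site → (v1GVecInstance (d := d) 𝔄 ι L hL j).gc.Site → ℝ)
    (F : T4Family) (θ : Stage13Params F N) (hP : θ.Provisos₁₃ F N) (g₀ : ℕ → ℝ) (os : List (ULoop F)) :
    ((readingOfRecord₁₃ w1 ℓ₃
      (fun _ _ _ _ _ =>
        { I := VecIndexS d L, c35 := c35, p := p, pi := v1GVecInstance (d := d) 𝔄 ι L hL, Kop := v1GVecFamily4 (d := d) 𝔄 ι e L hL,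
          Ksite := Ksite, Kunit := Kunit, inΛ := inΛ, unitDist := unitDist }) ne1).lit F θ hP g₀ os).Populated :=
  (readingOfRecord₁₃_populated_iff w1 ℓ₃ _ ne1 F θ hP g₀ os).2 fun _ => populated_v1GObjects e hL c35 p Ksite Kunit inΛ unitDist

end GaugeConst


/-! ## §5 Any residual layer: pin-meets-estimate and the LG-vector knit at the reading of record -/

section AnyLayer

variable (w1 : (F : T4Family) → (θ : Stage13Params F N) → ReadingData F (Node00.MatA N) θ.τ9.M) (ℓ₃ : T4Family → NE3Letters₁₁)
  (ne2 : (F : T4Family) → Stage13Params F N → (ℕ → ℝ) → List (ULoop F) → ℕ → NE2Objects₁₁)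
  (ne1 : (F : T4Family) → Stage13Params F N → (ℕ → ℝ) → List (ULoop F) → NE1pCarriers)

omit [NeZero L] in
/-- **THE θ-SUFFICIENT `h15` AT THE READING OF RECORD**: the N15 estimate at the residual layer's objects for every admissible tuple with provisos gives
`S_N15 (RRec₁₃ (readingOfRecord₁₃ w1 ℓ₃ ne2 ne1))` (part 33's `s_N15_rRec₁₃_of_forall_admissible` at the `rfl` face `readingOfRecord₁₃_ne2`). [bookkeeping] -/
theorem s_N15_readingOfRecord₁₃_of_forall_admissible
    (h : ∀ (F : T4Family) (θ : Stage13Params F N), θ.Provisos₁₃ F N → θ.Admissible F N → ∀ (g₀ : ℕ → ℝ) (os : List (ULoop F)) (k : ℕ),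
      N15At (ne2OfRecord₁₁ (ne2 F θ g₀ os k))) :
    S_N15 (RRec₁₃ (readingOfRecord₁₃ w1 ℓ₃ ne2 ne1)) :=
  s_N15_rRec₁₃_of_forall_admissible (readingOfRecord₁₃ w1 ℓ₃ ne2 ne1) fun F θ hP hA g₀ os k => h F θ hP hA g₀ os k

/-- **THE FAMILY-KEYED LG-VECTOR KNIT LAYER AT THE READING OF RECORD CLOSES N15's STUB HYPOTHESIS-FREE** [decided toy, non-degenerate]: a residual layer valued in
the `U ≡ 1` knit literals at the family's own `F.L` (`N15Knit.N15_with_zero_layers_dim4` at `HistoryFlow.two_le_L F`).  MODEL level, NOT Bałaban's `G(U)`. [bookkeeping] -/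
theorem s_N15_readingOfRecord₁₃_of_knit_family {μ ν : Fin 4} (hμν : μ ≠ ν) (a b μ' lam α β : Fin 4) (c35 p : ℝ)
    (h : ∀ (F : T4Family) (θ : Stage13Params F N) (g₀ : ℕ → ℝ) (os : List (ULoop F)) (k : ℕ),
      ne2 F θ g₀ os k =
        haveI := neZero_blockFactor F
        { I := KnitIndex 3 F.L, c35 := c35, p := p, pi := knitInstance 3 F.L, Kop := knitOp166 F.L μ ν a b, Ksite := knitSite163 F.L μ' lam,
          Kunit := covOpKernels F.L α β, inΛ := inAll F.L, unitDist := rhoDist F.L }) :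
    S_N15 (RRec₁₃ (readingOfRecord₁₃ w1 ℓ₃ ne2 ne1)) :=
  s_N15_readingOfRecord₁₃_of_forall_admissible w1 ℓ₃ ne2 ne1 fun F θ _ _ g₀ os k => by
    haveI := neZero_blockFactor F
    rw [h F θ g₀ os k]
    exact (N15_with_zero_layers_dim4 F.L (two_le_L F) hμν a b μ' lam α β c35 p).1

end AnyLayer

/-! ## §6 The K3‴ composer's TUPLE READING OF RECORD `rr := rateCarriersOfRecord₁₃ (readingOfRecord₁₃ …) … (ksel …)`: N15's conjunct of `KeyedRates rr` -/

section Tuple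

variable (w1 : (F : T4Family) → (θ : Stage13Params F N) → ReadingData F (Node00.MatA N) θ.τ9.M) (ℓ₃ : T4Family → NE3Letters₁₁)
  (ne2 : (F : T4Family) → Stage13Params F N → (ℕ → ℝ) → List (ULoop F) → ℕ → NE2Objects₁₁)
  (ne1 : (F : T4Family) → Stage13Params F N → (ℕ → ℝ) → List (ULoop F) → NE1pCarriers)
  (ksel : (F : T4Family) → (θ : Stage13Params F N) → θ.Provisos₁₃ F N → (ℕ → ℝ) → List (ULoop F) → ℕ)

omit [NeZero L] in
/-- **N15's CONJUNCT OF `KeyedRates rr` AT THE TUPLE READING OF RECORD IS THE N15 ESTIMATE AT THE RESIDUAL LAYER's OBJECTS, RUN LENGTH `ksel`** (`Iff.rfl` through the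
`rfl` faces of the bundle and of the reading). [bookkeeping] -/
theorem n15_tupleReadingOfRecord₁₃_iff :
    (∀ (F : T4Family) (θ : Stage13Params F N) (hP : θ.Provisos₁₃ F N), θ.Admissible F N → ∀ (g₀ : ℕ → ℝ) (os : List (ULoop F)),
        N15At (rateCarriersOfRecord₁₃ (readingOfRecord₁₃ w1 ℓ₃ ne2 ne1) F θ hP g₀ os (ksel F θ hP g₀ os)).ne2) ↔
      ∀ (F : T4Family) (θ : Stage13Params F N) (hP : θ.Provisos₁₃ F N), θ.Admissible F N → ∀ (g₀ : ℕ → ℝ) (os : List (ULoop F)),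
        N15At (ne2OfRecord₁₁ (ne2 F θ g₀ os (ksel F θ hP g₀ os))) :=
  Iff.rfl

omit [NeZero L] in
/-- **PIN MEETS ESTIMATE AT THE TUPLE READING OF RECORD**: the N15 estimate at `ne2OfRecord₁₁ (ne2 F θ g₀ os k)` for every admissible tuple with provisos and EVERY run
length gives N15's conjunct of `KeyedRates rr` for the composer's `rr`, whatever the selector `ksel`. [bookkeeping] -/
theorem n15_tupleReadingOfRecord₁₃_of_forall
    (h : ∀ (F : T4Family) (θ : Stage13Params F N), θ.Provisos₁₃ F N → θ.Admissible F N → ∀ (g₀ : ℕ → ℝ) (os : List (ULoop F)) (k : ℕ),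
      N15At (ne2OfRecord₁₁ (ne2 F θ g₀ os k))) :
    ∀ (F : T4Family) (θ : Stage13Params F N) (hP : θ.Provisos₁₃ F N), θ.Admissible F N → ∀ (g₀ : ℕ → ℝ) (os : List (ULoop F)),
      N15At (rateCarriersOfRecord₁₃ (readingOfRecord₁₃ w1 ℓ₃ ne2 ne1) F θ hP g₀ os (ksel F θ hP g₀ os)).ne2 :=
  fun F θ hP hA g₀ os => h F θ hP hA g₀ os (ksel F θ hP g₀ os)

/-- **THE KNIT LAYER CLOSES N15's CONJUNCT FOR THE COMPOSER's `rr`, HYPOTHESIS-FREE** [decided toy]. [bookkeeping] -/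
theorem n15_tupleReadingOfRecord₁₃_of_knit_family {μ ν : Fin 4} (hμν : μ ≠ ν) (a b μ' lam α β : Fin 4) (c35 p : ℝ)
    (h : ∀ (F : T4Family) (θ : Stage13Params F N) (g₀ : ℕ → ℝ) (os : List (ULoop F)) (k : ℕ),
      ne2 F θ g₀ os k =
        haveI := neZero_blockFactor F
        { I := KnitIndex 3 F.L, c35 := c35, p := p, pi := knitInstance 3 F.L, Kop := knitOp166 F.L μ ν a b, Ksite := knitSite163 F.L μ' lam,
          Kunit := covOpKernels F.L α β, inΛ := inAll F.L, unitDist := rhoDist F.L }) :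
    ∀ (F : T4Family) (θ : Stage13Params F N) (hP : θ.Provisos₁₃ F N), θ.Admissible F N → ∀ (g₀ : ℕ → ℝ) (os : List (ULoop F)),
      N15At (rateCarriersOfRecord₁₃ (readingOfRecord₁₃ w1 ℓ₃ ne2 ne1) F θ hP g₀ os (ksel F θ hP g₀ os)).ne2 :=
  n15_tupleReadingOfRecord₁₃_of_forall w1 ℓ₃ ne2 ne1 ksel fun F θ _ _ g₀ os k => by
    haveI := neZero_blockFactor F
    rw [h F θ g₀ os k]
    exact (N15_with_zero_layers_dim4 F.L (two_le_L F) hμν a b μ' lam α β c35 p).1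

/-- **dag-n15-c's `V′₁(A)`-LIVE LAYER CLOSES N15's CONJUNCT FOR THE COMPOSER's `rr`** (operator layer = the producer's theorem; site ∕ unit layers displayed).
[bookkeeping] -/
theorem n15_tupleReadingOfRecord₁₃_of_v1 (hd : 1 ≤ d) (hL : 1 ≤ L)
    (h : ∀ (F : T4Family) (θ : Stage13Params F N), θ.Provisos₁₃ F N → ∀ (g₀ : ℕ → ℝ) (os : List (ULoop F)) (k : ℕ),
      ∃ (c35 p : ℝ) (Ksite Kunit : ∀ j : VecIndexS d L, B9.SiteKernel (v1VecInstance (d := d) 𝔄 ι L hL j).gc (v1VecInstance (d := d) 𝔄 ι L hL j).Bf)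
        (inΛ : ∀ j : VecIndexS d L, (v1VecInstance (d := d) 𝔄 ι L hL j).gc.Site → Prop)
        (unitDist : ∀ j : VecIndexS d L, (v1VecInstance (d := d) 𝔄 ι L hL j).gc.Site → (v1VecInstance (d := d) 𝔄 ι L hL j).gc.Site → ℝ),
        0 < c35 ∧
        ne2 F θ g₀ os k =
          { I := VecIndexS d L, c35 := c35, p := p, pi := v1VecInstance (d := d) 𝔄 ι L hL, Kop := v1VecFamily4 (d := d) 𝔄 ι e L hL,
            Ksite := Ksite, Kunit := Kunit, inΛ := inΛ, unitDist := unitDist } ∧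
        NE2PlusSite 4 p c35 (v1VecInstance (d := d) 𝔄 ι L hL) Ksite ∧ NE2PlusUnit c35 (v1VecInstance (d := d) 𝔄 ι L hL) Kunit inΛ unitDist) :
    ∀ (F : T4Family) (θ : Stage13Params F N) (hP : θ.Provisos₁₃ F N), θ.Admissible F N → ∀ (g₀ : ℕ → ℝ) (os : List (ULoop F)),
      N15At (rateCarriersOfRecord₁₃ (readingOfRecord₁₃ w1 ℓ₃ ne2 ne1) F θ hP g₀ os (ksel F θ hP g₀ os)).ne2 :=
  n15_tupleReadingOfRecord₁₃_of_forall w1 ℓ₃ ne2 ne1 ksel fun F θ hP _ g₀ os k => by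
    obtain ⟨c35, p, Ksite, Kunit, inΛ, unitDist, hc35, hlit, hsite, hunit⟩ := h F θ hP g₀ os k
    rw [hlit]
    exact n15At_vectorPiece_v1_of_layers e hd hL hc35 p Ksite Kunit inΛ unitDist hsite hunit

end Tuple

end Summit.QuantumFields.YangMills.BalabanUVNodes.N15.AtRateReadingOfRecord13

end
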